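import Summits.BirchSwinnertonDyer.BirchSwinnertonDyer.Theses.UniversalToricDescent
import Summits.BirchSwinnertonDyer.BirchSwinnertonDyer.Theorems.UniversalToricDescentToricTransportModThreeStubRatSqueeze
import Summits.BirchSwinnertonDyer.BirchSwinnertonDyer.Theorems.UniversalToricDescentRationalSplitIMCInclusionAtThreeOfWall
import Mathlib.RingTheory.PowerSeries.Ideal
import Mathlib.RingTheory.UniqueFactorizationDomain.Multiplicity
import HarnessLib

/-!
# Crux `AdditiveSplitIMCInclusionAtThree` (stmt-BirchSwinnertonDyer-20395) — node `endoscopic_product`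
# (crux-ideate cover g29; UNREGISTERED node, `sorry` only in `stub_*`; concludes the crux BY NAME)

THE μ-HALF IS THE INVOLUTION-SYMMETRIC HALF.  Write `g = gen Ch_Λ(X_(∅ at 𝔭, 0 at 𝔭′))·R₀⟦T⟧`, `g′` the generator for the
conjugate Selmer structure `(∅ at 𝔭′, 0 at 𝔭)`, `ℒ = ℒ_𝔭`, `ℒ′ = ℒ_𝔭′` the two branch BDP series.  Complex conjugation swaps
`(X_𝔭, ℒ) ↔ (X_𝔭′, ℒ′)` semilinearly for `ι : T ↦ (1+T)⁻¹ − 1`, and `ι` FIXES the height-one prime `(3)` of `R₀⟦T⟧`.  Hence: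

* **SYMMETRIC PRODUCT** (`SymmetricProductIdentityAtThree`): `g·g′ ~ ℒ·ℒ′` in `R₀⟦T⟧` — the TOTAL cross congruence identity.
  Its natural engine is not an Euler system and not an Eisenstein family but the CUSPIDAL ENDOSCOPIC point: the Λ-adic
  Yoshida lift `𝐘 = θ(f_E ⊠ 𝐠)` (`𝐠` = CM Hida family of `K`, ordinary because `3` splits) on `GSp₄`, whose adjoint
  `ad(ρ_f ⊕ ρ_𝐠) ⊃ Hom(ρ_𝐠, ρ_f) ⊕ Hom(ρ_f, ρ_𝐠)` carries BOTH cross blocks, whose KLINGEN-ordinary flag `0 ⊂ ψ_𝔭 ⊂ ψ_𝔭^⊥`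
  (the line of extreme Hodge–Tate weight lies in `ρ_𝐠 = Ind ψ` for every `𝐠`-dominant weight; no line is asked of the
  supercuspidal `ρ_f|G_{ℚ₃}`) cuts out on the cross blocks EXACTLY the conditions (0 at 𝔭, ∅ at 𝔭′) ⊕ (∅ at 𝔭, 0 at 𝔭′),
  and whose congruence module is the Petersson norm of `𝐘` = `ℒ·ℒ′ ×` (adjoint factors of `f` and `𝐠`, known:
  Diamond–Flach–Guo / Kisin at fixed type, Rubin + Hida–Tilouine).  Wiles–Lenstra–Diamond: `R^{Kl}_𝐘 = 𝕋^{Kl}_{𝔪_𝐘}`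
  complete intersection ⟹ `Fitt(Sel_ad) = η_𝐘` ⟹ SYMMETRIC PRODUCT.  (See `Lines/endoscopic_product.md`.)
* **μ-SYMMETRY** (`MuSymmetryAtThree`): `3^m ∣ g ⟺ 3^m ∣ g′` and `3^m ∣ ℒ ⟺ 3^m ∣ ℒ′` (transport of structure by `c`;
  `ι(3) = 3`).
* **CONJUGATE TORIC DATUM** (`ConjugateToricExistsAtThree`): a nonzero BDP series for the conjugate branch exists on the frame.
* **RATWALL** (`RationalSplitIMCInclusionAtThree`, route crux 24207, LEAD line).

KERNEL (proved here): RATWALL ∧ CONJUGATE TORIC DATUM ∧ SYMMETRIC PRODUCT ∧ μ-SYMMETRY ⟹ WALL.  Valuation at the `ι`-fixed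
prime: `v₃(g)+v₃(g′) = v₃(ℒ)+v₃(ℒ′)` and symmetry give `v₃(g) ≤ v₃(ℒ)` (induction on `m`, `Prime.pow_dvd_of_dvd_mul_left`);
RATWALL `g ∣ 3ᵏℒ` then gives `g ∣ ℒ` (`WfDvdMonoid.max_power_factor'`, `dvd_of_dvd_prime_pow_mul`).  μ is never MEASURED
on either side — neither Hsieh's analytic `μ = 0` nor any algebraic `μ = 0` source is used; this is the delta to every
earlier node (g7 `wall_iff_ratwall_and_muDominance`, g18 POWERWALL ∧ UNIT, 24737 twin, #36 ghost).

Piece tags: RATWALL — WEAKER · LEAD; SYMMETRIC PRODUCT — UNDECIDED (implied by the two-branch equality, independent of the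
one-branch inclusion) · leaf IDEA-NEEDED→beyond print (`R^{Kl} = 𝕋` at the endoscopic point `ρ̄_f ⊕ ρ̄_𝐠` of `GSp₄` at
`p = 3`; Λ-adic Rallis/Böcherer–Schulze-Pillot inner product for `θ(f ⊠ 𝐠)`); μ-SYMMETRY — WEAKER · ATTACKABLE (transport
of structure) · INSTRUMENTABLE (F-g29-a); CONJUGATE TORIC DATUM — PRINT-ADJACENT (= `ToricExists` door at `𝔭′` +
Cornut–Vatsal non-vanishing).  Shred check: 4 stubs, none restates the crux (`g = ℒ′, g′ = ℒ` satisfies SYMMETRIC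
PRODUCT and μ-SYMMETRY, not the wall).  Disproof.lean: none on file for 20395 (checked g29).
-/

set_option linter.dupNamespace false
set_option autoImplicit false

noncomputable section

open scoped Classical NumberField
open NumberField IsDedekindDomain Field WeierstrassCurve
open Literature.NumberTheory.EllipticCurves Literature.NumberTheory.EllipticCurves.IwasawaAlgebra
open Literature.NumberTheory.EllipticCurves.ZpExtension
open Summit.BirchSwinnertonDyer.Rank1Residual.X11b Summit.BirchSwinnertonDyer.Rank1Residual.X11b.AcSelmer
open Summit.BirchSwinnertonDyer.BirchSwinnertonDyer.Theses.UniversalToricDescent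
  (RationalSplitIMCInclusionAtThree AdditiveSplitIMCInclusionAtThree)
open Summit.BirchSwinnertonDyer.BirchSwinnertonDyer.Cruxes.ToricTransportModThree.RatwallThinComb
  (dvd_of_dvd_prime_pow_mul prime_C_three)

namespace Summit.BirchSwinnertonDyer.BirchSwinnertonDyer.Cruxes.AdditiveSplitIMCInclusionAtThree.EndoscopicProduct

/-! ## §1 The pieces (Props over existing declarations; binders = the crux's + a conjugate-branch datum) -/

/-- **CONJUGATE TORIC DATUM** (PRINT-ADJACENT): on every frame of the crux there is a branch `ι″` inducing the OTHER
prime `𝔭′`, a `3`-adic period and a NONZERO power series satisfying the BDP interpolation predicate at `𝔭′`.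
[cite: Hsieh2014, Thm. B] [cite: CastellaHsieh2018, §3.3 Prop. 3.6] [cite: CornutVatsal2007, Thm. 1.5] -/
def ConjugateToricExistsAtThree : Prop :=
  ∀ (W : WeierstrassCurve ℚ) [W.IsElliptic] [W.IsGloballyMinimal] (N : ℕ) [NeZero N]
    (K : Type) [Field K] [NumberField K]
    (Dt : Literature.NumberTheory.EllipticCurves.ModularForms.ModularParametrizationData W N),
    Summit.BirchSwinnertonDyer.Rank1Residual.Additive.ClassO6 W 3 → W.HasSurjectiveModNGaloisRep 3 →
    W.analyticRank = 1 → W.conductorNorm ℤ = N →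
    IsImaginaryQuadratic K → SatisfiesHeegnerHypothesis N K →
    ∀ (κ : ZpExtension K 3), κ.IsAnticyclotomic →
    ∀ (γ : absoluteGaloisGroup K) [Fact (κ.IsTopGenerator γ)]
      (𝔭 : HeightOneSpectrum (𝓞 K)), ((3 : ℕ) : 𝓞 K) ∈ 𝔭.asIdeal →
      𝔭.asIdeal.ramificationIdx (𝓞 ℚ) = 1 → 𝔭.asIdeal.inertiaDeg (𝓞 ℚ) = 1 →
    ∀ (𝔭' : HeightOneSpectrum (𝓞 K)), ((3 : ℕ) : 𝓞 K) ∈ 𝔭'.asIdeal → 𝔭' ≠ 𝔭 →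
    ∀ (ι' : PadicAlgCl 3 ≃+* ℂ),
      Summit.BirchSwinnertonDyer.BirchSwinnertonDyer.Theorems.SchneiderFree.BranchInducesPrime 3 ι' 𝔭 →
    ∀ (ΩK : ℂ) (Ωp : ℂ_[3]) (L : UnrSeries 3), ΩK ≠ 0 → Ωp ≠ 0 →
      IsBDPLFunction ι' 𝔭 κ γ Dt.f ΩK Ωp L →
      ∃ (ι'' : PadicAlgCl 3 ≃+* ℂ) (Ωp'' : ℂ_[3]) (L' : UnrSeries 3),
        Summit.BirchSwinnertonDyer.BirchSwinnertonDyer.Theorems.SchneiderFree.BranchInducesPrime 3 ι'' 𝔭' ∧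
        Ωp'' ≠ 0 ∧ IsBDPLFunction ι'' 𝔭' κ γ Dt.f ΩK Ωp'' L' ∧ L' ≠ 0

/-- **SYMMETRIC PRODUCT** (UNDECIDED; the lever): on every frame and for every conjugate-branch datum, the generators of
the two mapped characteristic ideals (`X` strict at `𝔭′`, resp. strict at `𝔭`) have product ASSOCIATED to `ℒ·ℒ′` in
`R₀⟦T⟧` — the total cross congruence identity of the Λ-adic Yoshida lift `θ(f_E ⊠ 𝐠)` (Klingen-ordinary numerical
criterion at the endoscopic point; inner product formula).
[cite: BoechererSchulzePillot1991, Thm. 4.2] [cite: AgarwalKlosin2013, Thm. 6.6 (arXiv:1003.0374)]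
[cite: Wiles1995, Appendix (numerical criterion)] [cite: BergerKlosin2013, §6.4 (arXiv:1103.5100 p. 15)] -/
def SymmetricProductIdentityAtThree : Prop :=
  ∀ (W : WeierstrassCurve ℚ) [W.IsElliptic] [W.IsGloballyMinimal] (N : ℕ) [NeZero N]
    (K : Type) [Field K] [NumberField K]
    (Dt : Literature.NumberTheory.EllipticCurves.ModularForms.ModularParametrizationData W N),
    Summit.BirchSwinnertonDyer.Rank1Residual.Additive.ClassO6 W 3 → W.HasSurjectiveModNGaloisRep 3 →
    W.analyticRank = 1 → W.conductorNorm ℤ = N →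
    IsImaginaryQuadratic K → SatisfiesHeegnerHypothesis N K →
    ∀ (κ : ZpExtension K 3), κ.IsAnticyclotomic →
    ∀ (γ : absoluteGaloisGroup K) [Fact (κ.IsTopGenerator γ)]
      (𝔭 : HeightOneSpectrum (𝓞 K)), ((3 : ℕ) : 𝓞 K) ∈ 𝔭.asIdeal →
      𝔭.asIdeal.ramificationIdx (𝓞 ℚ) = 1 → 𝔭.asIdeal.inertiaDeg (𝓞 ℚ) = 1 →
    ∀ (𝔭' : HeightOneSpectrum (𝓞 K)), ((3 : ℕ) : 𝓞 K) ∈ 𝔭'.asIdeal → 𝔭' ≠ 𝔭 →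
    ∀ (ι' : PadicAlgCl 3 ≃+* ℂ),
      Summit.BirchSwinnertonDyer.BirchSwinnertonDyer.Theorems.SchneiderFree.BranchInducesPrime 3 ι' 𝔭 →
    ∀ (ΩK : ℂ) (Ωp : ℂ_[3]) (L : UnrSeries 3), ΩK ≠ 0 → Ωp ≠ 0 →
      IsBDPLFunction ι' 𝔭 κ γ Dt.f ΩK Ωp L →
    ∀ (ι'' : PadicAlgCl 3 ≃+* ℂ) (Ωp'' : ℂ_[3]) (L' : UnrSeries 3),
      Summit.BirchSwinnertonDyer.BirchSwinnertonDyer.Theorems.SchneiderFree.BranchInducesPrime 3 ι'' 𝔭' →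
      Ωp'' ≠ 0 → IsBDPLFunction ι'' 𝔭' κ γ Dt.f ΩK Ωp'' L' →
      ∃ g g' : UnrSeries 3,
        (XAc.charIdeal (W.baseChange K) 3 κ 𝔭' ∅ γ).map (PowerSeries.map (Halves.toUnr 3)) = Ideal.span {g} ∧
        (XAc.charIdeal (W.baseChange K) 3 κ 𝔭 ∅ γ).map (PowerSeries.map (Halves.toUnr 3)) = Ideal.span {g'} ∧
        Associated (g * g') (L * L')

/-- **μ-SYMMETRY** (WEAKER; ATTACKABLE by transport of structure along complex conjugation, which swaps the two Selmer
structures and the two branches semilinearly for `ι : T ↦ (1+T)⁻¹ − 1`, an automorphism of `R₀⟦T⟧` fixing the ideal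
`(3^m)`): divisibility of the two characteristic ideals, resp. the two branch series, by `3^m` is symmetric.
[cite: Castella2018, Def. 2.2 (arXiv:1704.06608 p. 5)] [cite: Washington1997, §13.2] -/
def MuSymmetryAtThree : Prop :=
  ∀ (W : WeierstrassCurve ℚ) [W.IsElliptic] [W.IsGloballyMinimal] (N : ℕ) [NeZero N]
    (K : Type) [Field K] [NumberField K]
    (Dt : Literature.NumberTheory.EllipticCurves.ModularForms.ModularParametrizationData W N),
    Summit.BirchSwinnertonDyer.Rank1Residual.Additive.ClassO6 W 3 → W.HasSurjectiveModNGaloisRep 3 →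
    W.analyticRank = 1 → W.conductorNorm ℤ = N →
    IsImaginaryQuadratic K → SatisfiesHeegnerHypothesis N K →
    ∀ (κ : ZpExtension K 3), κ.IsAnticyclotomic →
    ∀ (γ : absoluteGaloisGroup K) [Fact (κ.IsTopGenerator γ)]
      (𝔭 : HeightOneSpectrum (𝓞 K)), ((3 : ℕ) : 𝓞 K) ∈ 𝔭.asIdeal →
      𝔭.asIdeal.ramificationIdx (𝓞 ℚ) = 1 → 𝔭.asIdeal.inertiaDeg (𝓞 ℚ) = 1 →
    ∀ (𝔭' : HeightOneSpectrum (𝓞 K)), ((3 : ℕ) : 𝓞 K) ∈ 𝔭'.asIdeal → 𝔭' ≠ 𝔭 →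
    ∀ (ι' : PadicAlgCl 3 ≃+* ℂ),
      Summit.BirchSwinnertonDyer.BirchSwinnertonDyer.Theorems.SchneiderFree.BranchInducesPrime 3 ι' 𝔭 →
    ∀ (ΩK : ℂ) (Ωp : ℂ_[3]) (L : UnrSeries 3), ΩK ≠ 0 → Ωp ≠ 0 →
      IsBDPLFunction ι' 𝔭 κ γ Dt.f ΩK Ωp L →
    ∀ (ι'' : PadicAlgCl 3 ≃+* ℂ) (Ωp'' : ℂ_[3]) (L' : UnrSeries 3),
      Summit.BirchSwinnertonDyer.BirchSwinnertonDyer.Theorems.SchneiderFree.BranchInducesPrime 3 ι'' 𝔭' →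
      Ωp'' ≠ 0 → IsBDPLFunction ι'' 𝔭' κ γ Dt.f ΩK Ωp'' L' →
      (∀ m : ℕ,
        (XAc.charIdeal (W.baseChange K) 3 κ 𝔭' ∅ γ).map (PowerSeries.map (Halves.toUnr 3)) ≤
            Ideal.span {(PowerSeries.C ((3 : ℕ) : unrIntegers 3) : UnrSeries 3) ^ m} ↔
        (XAc.charIdeal (W.baseChange K) 3 κ 𝔭 ∅ γ).map (PowerSeries.map (Halves.toUnr 3)) ≤
            Ideal.span {(PowerSeries.C ((3 : ℕ) : unrIntegers 3) : UnrSeries 3) ^ m}) ∧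
      (∀ m : ℕ, (PowerSeries.C ((3 : ℕ) : unrIntegers 3) : UnrSeries 3) ^ m ∣ L ↔
        (PowerSeries.C ((3 : ℕ) : unrIntegers 3) : UnrSeries 3) ^ m ∣ L')

/-! ## §2 Kernel algebra in `R₀⟦T⟧` at the `ι`-fixed prime `3` (proved) -/

/-- **Valuation squeeze.**  In a domain with a prime `π`: if `g·g′ ~ L·L′`, `π^m ∣ g → π^m ∣ g′` and
`π^m ∣ L′ → π^m ∣ L` for all `m`, then `π^m ∣ g → π^m ∣ L` for all `m` (`v_π(g) ≤ v_π(L)`). [folklore] -/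
theorem pow_dvd_of_pow_dvd_of_associated {R : Type*} [CommRing R] [IsDomain R] {π g g' L L' : R} (hπ : Prime π)
    (hass : Associated (g * g') (L * L')) (hgg' : ∀ m : ℕ, π ^ m ∣ g → π ^ m ∣ g')
    (hLL' : ∀ m : ℕ, π ^ m ∣ L' → π ^ m ∣ L) : ∀ m : ℕ, π ^ m ∣ g → π ^ m ∣ L := by
  intro m
  induction m with
  | zero => intro _; exact ⟨L, by simp⟩
  | succ m ih =>
    intro hm
    obtain ⟨L₁, hL₁⟩ := ih ((pow_dvd_pow π m.le_succ).trans hm)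
    by_contra hcon
    have hL₁ndvd : ¬ π ∣ L₁ := fun h ↦ hcon (by rw [hL₁, pow_succ]; exact mul_dvd_mul_left _ h)
    have hm' : π ^ (m + 1) ∣ g' := hgg' (m + 1) hm
    obtain ⟨u, hu⟩ := hass
    have h2 : π ^ (m + 1) * π ^ (m + 1) ∣ L * L' := by
      rw [← hu]; exact (mul_dvd_mul hm hm').mul_right _
    have h3 : π ^ (m + 2) ∣ L₁ * L' := by
      have hre : π ^ (m + 1) * π ^ (m + 1) = π ^ m * π ^ (m + 2) := by ring
      rw [hre, hL₁, mul_assoc] at h2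
      exact (mul_dvd_mul_iff_left (pow_ne_zero _ hπ.ne_zero)).mp h2
    have h4 : π ^ (m + 2) ∣ L' := hπ.pow_dvd_of_dvd_mul_left (m + 2) hL₁ndvd h3
    have h5 : π ^ m * π ^ 2 ∣ π ^ m * L₁ := by
      have h := hLL' (m + 2) h4
      rw [hL₁, pow_add] at h
      exact h
    have h6 : π ^ 2 ∣ L₁ := (mul_dvd_mul_iff_left (pow_ne_zero _ hπ.ne_zero)).mp h5
    exact hL₁ndvd ((dvd_pow_self π two_ne_zero).trans h6)

/-- **Saturation.**  If `g ∣ π^k·L` and `v_π(g) ≤ v_π(L)` (in the divisibility form above) then `g ∣ L`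
(`R` a UFD-like domain: `WfDvdMonoid`). [folklore] -/
theorem dvd_of_dvd_pow_mul_of_pow_dvd {R : Type*} [CommRing R] [IsDomain R] [WfDvdMonoid R] {π g L : R}
    (hπ : Prime π) (hg0 : g ≠ 0) {k : ℕ} (hk : g ∣ π ^ k * L)
    (hv : ∀ m : ℕ, π ^ m ∣ g → π ^ m ∣ L) : g ∣ L := by
  obtain ⟨n, g₀, hg₀, hgfac⟩ := WfDvdMonoid.max_power_factor' hg0 hπ.not_unit
  obtain ⟨L₁, hL₁⟩ := hv n (hgfac ▸ dvd_mul_right (π ^ n) g₀)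
  have hk' : g₀ ∣ π ^ k * L₁ := by
    have h := hk
    rw [hgfac, hL₁, mul_left_comm] at h
    exact (mul_dvd_mul_iff_left (pow_ne_zero _ hπ.ne_zero)).mp h
  rw [hgfac, hL₁]
  exact mul_dvd_mul_left _ (dvd_of_dvd_prime_pow_mul hπ hg₀ k hk')

/-! ## §3 KERNEL: RATWALL ∧ CONJUGATE TORIC DATUM ∧ SYMMETRIC PRODUCT ∧ μ-SYMMETRY ⟹ WALL (proved; BY NAME) -/

/-- **The wall from RATWALL + the symmetric product + μ-symmetry.** [cite: Washington1997, §13.2] -/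
theorem wall_of_ratwall_of_symmetricProduct :
    RationalSplitIMCInclusionAtThree → ConjugateToricExistsAtThree → SymmetricProductIdentityAtThree →
      MuSymmetryAtThree → AdditiveSplitIMCInclusionAtThree := by
  intro hR hT hP hS W _ _ N _ K _ _ Dt hO6 hsurj hr1 hN hK hH κ hκ γ _ 𝔭 h3 he hf 𝔭' h3' hne ι' hι ΩK Ωp L hΩK hΩp hL
  by_cases hL0 : L = 0
  · rw [hL0, Ideal.span_singleton_eq_bot.mpr rfl]; exact bot_le
  obtain ⟨ι'', Ωp'', L', hι'', hΩp'', hL', hL'0⟩ :=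
    hT W N K Dt hO6 hsurj hr1 hN hK hH κ hκ γ 𝔭 h3 he hf 𝔭' h3' hne ι' hι ΩK Ωp L hΩK hΩp hL
  obtain ⟨k, hk⟩ := hR W N K Dt hO6 hsurj hr1 hN hK hH κ hκ γ 𝔭 h3 he hf 𝔭' h3' hne ι' hι ΩK Ωp L hΩK hΩp hL
  obtain ⟨g, g', hg, hg', hass⟩ :=
    hP W N K Dt hO6 hsurj hr1 hN hK hH κ hκ γ 𝔭 h3 he hf 𝔭' h3' hne ι' hι ΩK Ωp L hΩK hΩp hL ι'' Ωp'' L' hι'' hΩp'' hL'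
  obtain ⟨hSX, hSL⟩ :=
    hS W N K Dt hO6 hsurj hr1 hN hK hH κ hκ γ 𝔭 h3 he hf 𝔭' h3' hne ι' hι ΩK Ωp L hΩK hΩp hL ι'' Ωp'' L' hι'' hΩp'' hL'
  simp only [hg, hg', Ideal.span_singleton_le_span_singleton] at hSX
  rw [hg] at hk ⊢
  have hdvd : g ∣ ((3 : ℕ) : UnrSeries 3) ^ k * L := Ideal.mem_span_singleton.mp hk
  rw [← map_natCast (PowerSeries.C (R := unrIntegers 3))] at hdvd
  have hg0 : g ≠ 0 := by
    rintro rfl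
    obtain ⟨u, hu⟩ := hass
    simp only [zero_mul] at hu
    exact mul_ne_zero hL0 hL'0 hu.symm
  haveI := Summit.BirchSwinnertonDyer.Rank1Residual.X2.HidaLimitAlgebra.isDiscreteValuationRing_unrIntegers (p := 3)
  have hv : ∀ m : ℕ, (PowerSeries.C ((3 : ℕ) : unrIntegers 3) : UnrSeries 3) ^ m ∣ g →
      (PowerSeries.C ((3 : ℕ) : unrIntegers 3) : UnrSeries 3) ^ m ∣ L :=
    pow_dvd_of_pow_dvd_of_associated prime_C_three hass (fun m ↦ (hSX m).mp) (fun m ↦ (hSL m).mpr)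
  exact Ideal.span_singleton_le_span_singleton.mpr
    (dvd_of_dvd_pow_mul_of_pow_dvd prime_C_three hg0 hdvd hv)

/-- Shape witness (proved): the swapped pair `g = ℒ′, g′ = ℒ` satisfies the SYMMETRIC PRODUCT relation, so that stub
does not restate the wall. [folklore] -/
theorem symmetricProduct_shape_example (L L' : UnrSeries 3) : Associated (L' * L) (L * L') := by
  rw [mul_comm]

/-! ## §4 Stubs (the ONLY sorries) and the top composition -/

/-- RATWALL — route crux 24207 (LEAD line `ratwall_thin_comb`); WEAKER than the wall. -/
theorem stub_ratwall : RationalSplitIMCInclusionAtThree := by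
  sorry

/-- CONJUGATE TORIC DATUM — PRINT-ADJACENT (`ToricExists` door at `𝔭′` + Cornut–Vatsal non-vanishing). -/
theorem stub_conjugateToric : ConjugateToricExistsAtThree := by
  sorry

/-- SYMMETRIC PRODUCT — UNDECIDED; leaf IDEA-NEEDED (Klingen-ordinary `R = 𝕋` at the Yoshida point of `GSp₄`, `p = 3`). -/
theorem stub_symmetricProduct : SymmetricProductIdentityAtThree := by
  sorry

/-- μ-SYMMETRY — WEAKER; ATTACKABLE (transport of structure by complex conjugation). -/
theorem stub_muSymmetry : MuSymmetryAtThree := by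
  sorry

/-- **The wall from RATWALL + CONJUGATE TORIC DATUM + SYMMETRIC PRODUCT + μ-SYMMETRY.**  Concludes
`AdditiveSplitIMCInclusionAtThree` BY NAME. [cite: Washington1997, §13.2] -/
theorem AdditiveSplitIMCInclusionAtThree_of :
    RationalSplitIMCInclusionAtThree → ConjugateToricExistsAtThree → SymmetricProductIdentityAtThree →
      MuSymmetryAtThree → AdditiveSplitIMCInclusionAtThree :=
  wall_of_ratwall_of_symmetricProduct

/-- The top composition run on the stubs: the crux BY NAME (sorries only through `stub_*`). -/
theorem AdditiveSplitIMCInclusionAtThree_holds_of_stubs : AdditiveSplitIMCInclusionAtThree :=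
  AdditiveSplitIMCInclusionAtThree_of stub_ratwall stub_conjugateToric stub_symmetricProduct stub_muSymmetry

end Summit.BirchSwinnertonDyer.BirchSwinnertonDyer.Cruxes.AdditiveSplitIMCInclusionAtThree.EndoscopicProduct

end
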